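import Summits.PneNP.PneNP.Theorems.ConvexRankGatesCaptureCosetMeetToJoinAbelian
import HarnessLib

/-!
# Crux `Capture` (stmt-PneNP-2659), line `csp-spine-meet-to-join` — monotone module programs over the ring
# `ℤ/e` are an OR of `e - 1` PERM gates (`ring_span_program_cktSize`; R-a/R-c plumbing of the residual dossier)

Ring version of `span_program_cktSize`: a Boolean function of the selection `v` that fires iff SOME `(0, t)`,
`t ≠ 0`, lies in the additive closure (= `ℤ/e`-module) generated by the selected relation blocks
`R j ⊆ (Idx → ℤ/e) × ℤ/e` is computed by `≤ 2e + 1` gates of `permBasis S` once `e (|Idx| + 1) ≤ S`: one PERM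
gate per target `t` (translation-flip action of `(ℤ/e)^(Option Idx)`, `abelianProgram_isPermGate`), OR-folded
(`ab_cktSize_exists`). Over a ring the certificate of unsolvability is `(0, t)` for some nonzero, not
necessarily unit, `t` (Fredholm over `ℤ/m`, cf. `zmod_pseudo_solution`). Continuation lead c1, 2026-08-16.
[folklore]
-/

namespace Summit.PneNP.PneNP.Cruxes.Capture.CspSpineMeetToJoin

set_option linter.dupNamespace false -- `Summit.PneNP.PneNP.…`: summit = sub-problem (D-0017)

open Literature.Computability.Complexity
open Summit.PneNP.PneNP.Theorems.CliqueExtLowerBound.Negative (abelianProgram_isPermGate)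

/-- **Monotone module programs over `ℤ/e` are an OR of PERM gates** (registered sub-goal
`ring_span_program_cktSize`). [folklore] -/
theorem ring_span_program_cktSize : ∀ (e : ℕ) [NeZero e] (Idx : Type) [Fintype Idx] (m : ℕ)
    (R : Fin m → Set ((Idx → ZMod e) × ZMod e)) (f : (Fin m → Bool) → Bool),
    (∀ v, f v = true ↔ ∃ t : ZMod e, t ≠ 0 ∧ ((0 : Idx → ZMod e), t) ∈
      AddSubgroup.closure (⋃ j ∈ {j | v j = true}, R j)) →
    ∀ S : ℕ, e * (Fintype.card Idx + 1) ≤ S → CktSize (permBasis S) (fun v (_ : Unit) => f v) (2 * e + 1) := by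
  intro e _ Idx _ m R f hf S hS
  classical
  -- rows: all relations of all blocks, each owned by its block
  let Row : Type := Σ j : Fin m, {wb : (Idx → ZMod e) × ZMod e // wb ∈ R j}
  let N : ℕ := Fintype.card Row
  let eq : Row ≃ Fin N := Fintype.equivFin Row
  let wire : Fin N → Fin m := fun i => (eq.symm i).1
  -- coordinates `(w, b) ↦ (b, w)` in `Option Idx → ZMod e`
  let co : ((Idx → ZMod e) × ZMod e) →+ (Option Idx → ZMod e) :=
    { toFun := fun wb o => Option.elim o wb.2 wb.1
      map_zero' := by funext o; cases o <;> rfl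
      map_add' := fun a b => by funext o; cases o <;> rfl }
  have hco : Function.Injective co := fun a b h => by
    have h1 : ∀ o, co a o = co b o := fun o => by rw [h]
    exact Prod.ext (funext fun i => h1 (some i)) (h1 none)
  let ρ : Fin N → Option Idx → ZMod e := fun i => co (eq.symm i).2.1
  let P : ZMod e → (Fin N → Bool) → Bool := fun t u => decide (Multiplicative.ofAdd (co ((0 : Idx → ZMod e), t)) ∈
    Subgroup.closure ((fun i => Multiplicative.ofAdd (ρ i)) '' {i | u i = true}))
  have hPB : ∀ t, (⟨N, P t⟩ : GateFn) ∈ permBasis S := fun t => by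
    refine Or.inr ((abelianProgram_isPermGate ρ (co (0, t)) (P t) fun u => decide_eq_true_iff).mono ?_)
    rw [Fintype.card_prod, ZMod.card, Fintype.card_option]
    exact hS
  have hor : GateFn.or 2 ∈ permBasis S := by simp [permBasis, monConst]
  have h0 : GateFn.const false ∈ permBasis S := by simp [permBasis, monConst]
  -- semantics of the gate `t` on the selection `v`
  have hsem : ∀ t (v : Fin m → Bool), P t (fun i => v (wire i)) = true ↔
      ((0 : Idx → ZMod e), t) ∈ AddSubgroup.closure (⋃ j ∈ {j | v j = true}, R j) := by
    intro t v
    have hset : ρ '' {i | v (wire i) = true} = co '' (⋃ j ∈ {j | v j = true}, R j) := by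
      ext y
      simp only [Set.mem_image, Set.mem_setOf_eq, Set.mem_iUnion, exists_prop]
      constructor
      · rintro ⟨i, hi, rfl⟩
        exact ⟨(eq.symm i).2.1, ⟨(eq.symm i).1, hi, (eq.symm i).2.2⟩, rfl⟩
      · rintro ⟨wb, ⟨j, hj, hwb⟩, rfl⟩
        refine ⟨eq ⟨j, wb, hwb⟩, ?_, ?_⟩
        · show v (eq.symm (eq ⟨j, wb, hwb⟩)).1 = true
          rw [Equiv.symm_apply_apply]; exact hj
        · show co (eq.symm (eq ⟨j, wb, hwb⟩)).2.1 = co wb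
          rw [Equiv.symm_apply_apply]
    have hmul : Multiplicative.ofAdd (co ((0 : Idx → ZMod e), t)) ∈
        Subgroup.closure ((fun i => Multiplicative.ofAdd (ρ i)) '' {i | v (wire i) = true}) ↔
        co ((0 : Idx → ZMod e), t) ∈ AddSubgroup.closure (ρ '' {i | v (wire i) = true}) := by
      rw [← Set.image_image Multiplicative.ofAdd ρ, Equiv.image_eq_preimage_symm,
        Multiplicative.ofAdd_symm_eq, ← AddSubgroup.toSubgroup_closure, Multiplicative.mem_toSubgroup,
        toAdd_ofAdd]
    simp only [P, decide_eq_true_eq]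
    rw [hmul, hset, ← AddMonoidHom.map_closure, AddSubgroup.mem_map_iff_mem hco]
  -- OR over the nonzero targets
  have hsize := ab_cktSize_exists hor h0 (fun t (v : Fin m → Bool) => P t (fun i => v (wire i)))
    (Finset.univ.filter fun t : ZMod e => t ≠ 0)
    (fun t _ => CktSize.gate (B := permBasis S) ⟨N, P t⟩ (hPB t) wire)
  refine (hsize.congr fun v _ => ?_).of_le ?_
  · rw [Bool.eq_iff_iff, hf v]
    simp only [Finset.mem_filter, Finset.mem_univ, true_and, decide_eq_true_eq, hsem]
  · have : (Finset.univ.filter fun t : ZMod e => t ≠ 0).card ≤ e :=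
      (Finset.card_filter_le _ _).trans (by rw [Finset.card_univ, ZMod.card])
    omega

end Summit.PneNP.PneNP.Cruxes.Capture.CspSpineMeetToJoin
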